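import Literature.MathematicalPhysics.QuantumLattice.MPSBlockedTensorSweep
import Literature.MathematicalPhysics.QuantumLattice.ProductOperators
import HarnessLib

/-!
# Blocked MPS tensors on `n` sites: the product-weighted Heisenberg map is the `n`-fold iterated sweep

Family `hubbard` / tensor networks (topic `MathematicalPhysics/QuantumLattice`); the `n`-site
iteration of `MPSBlockedTensorSweep` (`opSandwich_consTensor_kronecker`, two sites).

For SITE-DEPENDENT tensors `k_i = (k_i^s)_{s : σ}`, `i < n`, with a common square bond index `β`
(rectangular bonds are covered by zero-padding into a common `β`), the blocked `n`-site tensor is the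
word `wordTensor k S = k_0^{S 0} k_1^{S 1} ⋯ k_{n-1}^{S (n-1)}` on the alphabet `Fin n → σ`
(Perez-Garcia–Verstraete–Wolf–Cirac 2007 §2, blocking; for a uniform tensor this is
`MatrixProductStates.wordProduct`). For one-site insertions `u_i : Matrix σ σ R` the product insertion
is `piOp u`, entrywise `∏_i (u_i)_{S_i T_i}` (over `ℂ` literally `ProductOperators.productOp u`,
`piOp_eq_productOp`). The iterated sweep `iterSweep n k u M = Φ^{u_{n-1}}_{k_{n-1}}(⋯ Φ^{u_0}_{k_0}(M) ⋯)`
applies the one-site operator-weighted Heisenberg maps `Φ^{u}_{k}(M) = opSandwich k u M` in turn,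
site `0` innermost. **Theorem** (`opSandwich_wordTensor_piOp`):

  `opSandwich (wordTensor k) (piOp u) M = iterSweep n k u M`,

i.e. `Σ_{S T} (∏_i (u_i)_{S_i T_i}) (k^S)ᴴ M k^T` — one step on an alphabet of size `|σ|^n` — equals
`n` one-site steps (Schollwöck 2011 §4.2.1: iterative evaluation of MPS contractions, cost linear in
the number of sites). Proof: peel site `0` with `Fin.consEquiv`, apply the two-site lemma, induct.

Pure finite-sum algebra over a commutative star-ring `R` (`ℂ`; `ℤ` for integer twins); no gauge
condition; no model. Provenance: the cited sections define the objects and use the identity as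
routine; the Lean statements/proofs are ours.

## References
* U. Schollwöck, Ann. Phys. 326 (2011) 96–192, §4.2.1. [cite: Schollwoeck2011AnnPhys, §4.2.1]
* D. Perez-Garcia, F. Verstraete, M. M. Wolf, J. I. Cirac, Quantum Inf. Comput. 7 (2007) 401, §2.
  [cite: PerezGarciaVerstraeteWolfCiracQIC2007, §2]
-/

namespace Literature.MathematicalPhysics.QuantumLattice

open Matrix
open scoped Kronecker

section General

variable {R : Type*} [CommRing R] [StarRing R]
variable {σ β : Type*} [Fintype σ] [Fintype β] [DecidableEq β]

/-- The blocked `n`-site tensor of site-dependent tensors `k_i` (common square bond index `β`):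
`wordTensor k S = k_0^{S 0} k_1^{S 1} ⋯ k_{n-1}^{S (n-1)}` (empty word = `1`).
Perez-Garcia–Verstraete–Wolf–Cirac (2007) §2 (blocking; `wordProduct` for a uniform tensor).
[cite: PerezGarciaVerstraeteWolfCiracQIC2007, §2] -/
def wordTensor {n : ℕ} (k : Fin n → σ → Matrix β β R) (S : Fin n → σ) : Matrix β β R :=
  (List.ofFn fun i => k i (S i)).prod

/-- The product insertion of one-site matrices `u_i : Matrix σ σ R` on the alphabet `Fin n → σ`:
`(piOp u)_{S T} = ∏_i (u_i)_{S_i T_i}` (over `ℂ` this is `productOp u`, see `piOp_eq_productOp`).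
Tasaki-style product operator, Schollwöck (2011) §4.2.1 (operator insertions). [cite: Schollwoeck2011AnnPhys, §4.2.1] -/
def piOp {n : ℕ} (u : Fin n → Matrix σ σ R) : Matrix (Fin n → σ) (Fin n → σ) R :=
  Matrix.of fun S T => ∏ i, u i (S i) (T i)

/-- The `n`-fold iterated one-site sweep `Φ^{u_{n-1}}_{k_{n-1}} ∘ ⋯ ∘ Φ^{u_0}_{k_0}` applied to `M`
(site `0` innermost). Schollwöck (2011) §4.2.1 (iterative contraction). [cite: Schollwoeck2011AnnPhys, §4.2.1] -/
def iterSweep : (n : ℕ) → (Fin n → σ → Matrix β β R) → (Fin n → Matrix σ σ R) → Matrix β β R →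
    Matrix β β R
  | 0, _, _, M => M
  | n + 1, k, u, M => iterSweep n (fun i => k i.succ) (fun i => u i.succ) (opSandwich (k 0) (u 0) M)

omit [StarRing R] [Fintype σ] [DecidableEq β] in
/-- Entries of the product insertion. [folklore] [cite: Schollwoeck2011AnnPhys, §4.2.1] -/
@[simp]
theorem piOp_apply {n : ℕ} (u : Fin n → Matrix σ σ R) (S T : Fin n → σ) :
    piOp u S T = ∏ i, u i (S i) (T i) := rfl

omit [StarRing R] [Fintype σ] in
/-- The empty word is `1`. [folklore] [cite: PerezGarciaVerstraeteWolfCiracQIC2007, §2] -/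
theorem wordTensor_zero (k : Fin 0 → σ → Matrix β β R) (S : Fin 0 → σ) : wordTensor k S = 1 := by
  simp [wordTensor]

omit [StarRing R] [Fintype σ] in
/-- Peeling the first letter: `k^S = k_0^{S 0} · (k_{·+1})^{tail S}`. [folklore]
[cite: PerezGarciaVerstraeteWolfCiracQIC2007, §2] -/
theorem wordTensor_succ {n : ℕ} (k : Fin (n + 1) → σ → Matrix β β R) (S : Fin (n + 1) → σ) :
    wordTensor k S = k 0 (S 0) * wordTensor (fun i => k i.succ) (Fin.tail S) := by
  simp [wordTensor, List.ofFn_succ, Fin.tail]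

omit [StarRing R] [Fintype σ] in
/-- Through `Fin.consEquiv`, the `(n+1)`-site word tensor is the two-site block (`consTensor`) of the
site-`0` tensor and the `n`-site word tensor of the remaining sites. [folklore]
[cite: PerezGarciaVerstraeteWolfCiracQIC2007, §2] -/
theorem wordTensor_consEquiv {n : ℕ} (k : Fin (n + 1) → σ → Matrix β β R) :
    (fun p => wordTensor k (Fin.consEquiv (fun _ => σ) p)) =
      consTensor (k 0) (wordTensor fun i => k i.succ) := by
  funext p
  rw [consTensor_apply, wordTensor_succ]
  simp [Fin.consEquiv]

omit [StarRing R] [Fintype σ] [Fintype β] [DecidableEq β] in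
/-- Through `Fin.consEquiv`, the `(n+1)`-site product insertion is `u_0 ⊗ₖ` (the `n`-site one).
[folklore] [cite: Schollwoeck2011AnnPhys, §4.2.1] -/
theorem piOp_submatrix_consEquiv {n : ℕ} (u : Fin (n + 1) → Matrix σ σ R) :
    (piOp u).submatrix (Fin.consEquiv fun _ => σ) (Fin.consEquiv fun _ => σ) =
      u 0 ⊗ₖ piOp (fun i => u i.succ) := by
  ext ⟨a, S⟩ ⟨b, T⟩
  simp only [submatrix_apply, piOp_apply, kroneckerMap_apply, Fin.prod_univ_succ,
    Fin.consEquiv_apply, Fin.cons_zero, Fin.cons_succ]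

/-- **The `n`-site sweep theorem.** The product-weighted Heisenberg map of the blocked `n`-site tensor
equals the `n`-fold iterated one-site sweep:
`Σ_{S T} (∏_i (u_i)_{S_i T_i}) (k^S)ᴴ M k^T = Φ^{u_{n-1}}_{k_{n-1}}(⋯ Φ^{u_0}_{k_0}(M) ⋯)`.
Schollwöck (2011) §4.2.1. [cite: Schollwoeck2011AnnPhys, §4.2.1] -/
theorem opSandwich_wordTensor_piOp :
    ∀ (n : ℕ) (k : Fin n → σ → Matrix β β R) (u : Fin n → Matrix σ σ R) (M : Matrix β β R),
      opSandwich (wordTensor k) (piOp u) M = iterSweep n k u M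
  | 0, k, u, M => by
    rw [iterSweep, opSandwich_def, Fintype.sum_unique, Fintype.sum_unique, piOp_apply,
      Fintype.prod_empty, one_smul, wordTensor_zero, conjTranspose_one, Matrix.one_mul,
      Matrix.mul_one]
  | n + 1, k, u, M => by
    rw [iterSweep, ← opSandwich_wordTensor_piOp n,
      ← opSandwich_reindex (Fin.consEquiv fun _ => σ) (wordTensor k) (piOp u) M,
      piOp_submatrix_consEquiv, wordTensor_consEquiv, opSandwich_consTensor_kronecker]

/-- The `n`-site sweep theorem with no insertion (`u_i = 1`): the plain Heisenberg map of a blocked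
tensor is the composite of the one-site Heisenberg maps.
Perez-Garcia–Verstraete–Wolf–Cirac (2007) §2.1. [cite: PerezGarciaVerstraeteWolfCiracQIC2007, §2.1] -/
theorem opSandwich_wordTensor_one [DecidableEq σ] {n : ℕ} (k : Fin n → σ → Matrix β β R)
    (M : Matrix β β R) :
    opSandwich (wordTensor k) 1 M = iterSweep n k (fun _ => 1) M := by
  rw [← opSandwich_wordTensor_piOp]
  congr 1
  ext S T
  rw [piOp_apply, one_apply]
  by_cases h : S = T
  · subst h
    simp
  · rw [if_neg h]
    obtain ⟨i, hi⟩ := Function.ne_iff.mp h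
    symm
    exact Finset.prod_eq_zero (Finset.mem_univ i) (Matrix.one_apply_ne hi)

end General

section Complex

variable {q n : ℕ}

/-- Over `ℂ` the product insertion IS the product operator of `ProductOperators` on the chain
`Fin n`. [folklore] [cite: Schollwoeck2011AnnPhys, §4.2.1] -/
theorem piOp_eq_productOp (u : Fin n → Matrix (Fin q) (Fin q) ℂ) : piOp u = productOp u := rfl

end Complex

end Literature.MathematicalPhysics.QuantumLattice
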